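import Literature.MathematicalPhysics.StatisticalMechanics.PeriodicConfigurationSums
import Literature.MathematicalPhysics.StatisticalMechanics.LennardJonesClusters
import Literature.Geometry.DiscreteGeometry.KissingPatterns
import HarnessLib
import Summits.AtomisticToContinuum.Crystallization.Theorems.ReggeStarCoercivityPeriodicStarCoercivityDefs

/-!
# `PeriodicStarCoercivity` (route `ReggeStarCoercivity`, stmt-AtomisticToContinuum-13602), line `pinned-equilibria-reduction`:
stub S5 `stub_collarCount` — the collar of the junk has at most `40 R³` near sites per far-defective motif site

Registered stub (skeleton `Cruxes/PeriodicStarCoercivity/Lines/pinned_equilibria_reduction.lean`):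
`∃ C : ℝ, ∀ R : ℝ, 1 ≤ R → ∀ P : PC, ((collarSet R P).card : ℝ) ≤ C * R ^ 3 * ((farDefSet P).card : ℝ)`
(vocabulary from `Theorems/ReggeStarCoercivityPeriodicStarCoercivityDefs.lean`: `collarSet R P` = `7/100`-near motif
sites within `R` of a far-defective point of `P.points`; `farDefSet P` = far-defective motif sites).

Proof (pure packing geometry, `C = 40`):
* lattice invariance of shells and statuses (`shell_add_of_mem_lattice`, `near_add_iff`, `isFree_add_iff`): a
  far-defective point `y = m + g` of `P.points` has a far-defective motif representative `m ∈ farDefSet P`;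
* separation at near sites (`le_dist_of_near`, `dist_ge_of_near`): a shell `η`-close to a pattern of unit vectors
  has all its points of norm `≥ 1 − η`, so at a `7/100`-near site every other point of `P` lies at distance
  `≥ (9/10)(93/100) = 0.837`;
* packing (`card_near_ball_le`, from the tree's `card_le_of_separated_of_dist_le`): at most
  `(2R/0.837 + 1)³ ≤ 40 R³` near points of `P` within `R ≥ 1` of any point;
* the map `s ↦ s − g(s)` (with `y(s) = m(s) + g(s)` a chosen far witness) is injective on the collar (motif points
  are inequivalent modulo the lattice, `eq_of_sub_mem`) and sends a collar site to a near point of `P` within `R`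
  of `m(s) ∈ farDefSet P`; summing over `m` gives the bound (`Finset.card_biUnion_le`).
All `[folklore]`.
-/

noncomputable section

open scoped BigOperators Classical
open Literature.MathematicalPhysics.StatisticalMechanics Literature.Geometry.DiscreteGeometry

namespace Summit.AtomisticToContinuum.Crystallization.Theorems.ReggeStarCoercivityPeriodicStarCoercivity

local notation "E3" => EuclideanSpace ℝ (Fin 3)
local notation "PC" => PeriodicConfiguration 3

/-! ## Lattice invariance of shells and statuses -/

/-- The recentred shell is invariant under the lattice of periods: `shell P (s + g) a = shell P s a`. -/
theorem shell_add_of_mem_lattice (P : PC) {g : E3} (hg : g ∈ P.lattice) (s : E3) (a : ℝ) :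
    shell P (s + g) a = shell P s a := by
  ext z
  simp only [shell, Finset.mem_image, Set.Finite.mem_toFinset, Set.mem_inter_iff, Set.mem_sdiff,
    Metric.mem_closedBall, Set.mem_singleton_iff]
  constructor
  · rintro ⟨y, ⟨⟨hyb, hys⟩, hyp⟩, rfl⟩
    refine ⟨y - g, ⟨⟨?_, ?_⟩, ?_⟩, ?_⟩
    · have : dist (y - g) s = dist y (s + g) := by
        rw [dist_eq_norm, dist_eq_norm]; congr 1; abel
      rw [this]; exact hyb
    · intro h; exact hys (eq_add_of_sub_eq h)
    · have := P.add_mem_points hyp (P.lattice.neg_mem hg)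
      simpa [sub_eq_add_neg] using this
    · congr 1; abel
  · rintro ⟨y, ⟨⟨hyb, hys⟩, hyp⟩, rfl⟩
    refine ⟨y + g, ⟨⟨?_, ?_⟩, ?_⟩, ?_⟩
    · have : dist (y + g) (s + g) = dist y s := by simp
      rw [this]; exact hyb
    · intro h; exact hys (by simpa using h)
    · exact P.add_mem_points hyp hg
    · congr 1; abel

/-- Nearness is invariant under the lattice of periods. -/
theorem near_add_iff (η : ℝ) (P : PC) {g : E3} (hg : g ∈ P.lattice) (s : E3) :
    Near η P (s + g) ↔ Near η P s := by
  unfold Near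
  simp_rw [shell_add_of_mem_lattice P hg]

/-- Freeness is invariant under the lattice of periods. -/
theorem isFree_add_iff (P : PC) {g : E3} (hg : g ∈ P.lattice) (s : E3) :
    IsFree P (s + g) ↔ IsFree P s :=
  near_add_iff _ P hg s

/-! ## Near sites are `0.837`-separated from every other point -/

/-- A shell `η`-close to a pattern on the unit sphere has all its points of norm `≥ 1 − η`. -/
theorem one_sub_le_norm_of_shellCloseTo {η : ℝ} {T Q : Finset E3} (hQ : ∀ q ∈ Q, ‖q‖ = 1)
    (h : ShellCloseTo η T Q) : ∀ t ∈ T, 1 - η ≤ ‖t‖ := by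
  obtain ⟨A, e, he⟩ := h
  intro t ht
  have hp : ((e ⟨t, ht⟩ : E3)) ∈ Q.image A := (e ⟨t, ht⟩).2
  obtain ⟨q, hq, hqe⟩ := Finset.mem_image.1 hp
  have hnorm : ‖(e ⟨t, ht⟩ : E3)‖ = 1 := by rw [← hqe, A.norm_map, hQ q hq]
  have hd := he ⟨t, ht⟩
  have := norm_sub_norm_le (e ⟨t, ht⟩ : E3) t
  rw [hnorm, ← dist_eq_norm, dist_comm] at this
  have hd' : dist (t : E3) (e ⟨t, ht⟩ : E3) ≤ η := hd
  linarith

/-- At an `η`-near site `s`, every other point of `P` within `6/5` is at distance `≥ (9/10)(1 − η)`. -/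
theorem le_dist_of_near {η : ℝ} {P : PC} {s : E3} (h : Near η P s) {y : E3} (hy : y ∈ P.points)
    (hys : y ≠ s) (hd : dist y s ≤ 6 / 5) : 9 / 10 * (1 - η) ≤ dist y s := by
  obtain ⟨a, ha9, ha11, hclose⟩ := h
  have ha : 0 < a := by linarith
  have hz : a⁻¹ • (y - s) ∈ shell P s a := by
    unfold shell
    refine Finset.mem_image.2 ⟨y, ?_, rfl⟩
    rw [Set.Finite.mem_toFinset]
    exact ⟨⟨Metric.mem_closedBall.2 hd, by simpa using hys⟩, hy⟩
  have h1 : 1 - η ≤ ‖a⁻¹ • (y - s)‖ := by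
    rcases hclose with hc | hc
    · exact one_sub_le_norm_of_shellCloseTo (fun q hq => norm_eq_one_of_mem_fccKissingPattern hq) hc _ hz
    · exact one_sub_le_norm_of_shellCloseTo (fun q hq => norm_eq_one_of_mem_hcpKissingPattern hq) hc _ hz
  rw [norm_smul, norm_inv, Real.norm_of_nonneg ha.le, ← dist_eq_norm] at h1
  have h2 : a * (1 - η) ≤ dist y s := by
    have := mul_le_mul_of_nonneg_left h1 ha.le
    rwa [← mul_assoc, mul_inv_cancel₀ ha.ne', one_mul] at this
  by_cases hη : 1 - η ≤ 0
  · nlinarith [dist_nonneg (x := y) (y := s)]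
  · push Not at hη
    nlinarith

/-- At a `7/100`-near site `s`, every other point of `P` is at distance `≥ 0.837`. -/
theorem dist_ge_of_near {P : PC} {s : E3} (h : Near (7 / 100) P s) {y : E3} (hy : y ∈ P.points)
    (hys : y ≠ s) : 837 / 1000 ≤ dist y s := by
  by_cases hd : dist y s ≤ 6 / 5
  · have := le_dist_of_near h hy hys hd
    norm_num at this
    linarith
  · push Not at hd
    linarith

/-- Packing: at most `40 R³` near points of `P` lie within `R ≥ 1` of any point. -/
theorem card_near_ball_le (P : PC) (m : E3) {R : ℝ} (hR : 1 ≤ R) (S : Finset E3)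
    (hS : ∀ c ∈ S, c ∈ P.points ∧ Near (7 / 100) P c ∧ dist c m ≤ R) :
    (S.card : ℝ) ≤ 40 * R ^ 3 := by
  have h := card_le_of_separated_of_dist_le S m (r := 837 / 1000) (R := R) (by norm_num) (by linarith)
    (fun c hc => (hS c hc).2.2) ?_
  · rw [finrank_euclideanSpace, Fintype.card_fin] at h
    have hb : 2 * R / (837 / 1000) + 1 ≤ 339 / 100 * R := by
      rw [div_eq_mul_inv]
      norm_num
      nlinarith
    have h0 : 0 ≤ 2 * R / (837 / 1000) + 1 := by positivity
    have hR0 : 0 < R := by linarith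
    calc (S.card : ℝ) ≤ (2 * R / (837 / 1000) + 1) ^ 3 := h
      _ ≤ (339 / 100 * R) ^ 3 := pow_le_pow_left₀ h0 hb 3
      _ ≤ 40 * R ^ 3 := by nlinarith [pow_pos hR0 3]
  · intro c hc d hd hcd
    obtain ⟨hcP, -, -⟩ := hS c hc
    obtain ⟨-, hdN, -⟩ := hS d hd
    exact dist_ge_of_near hdN hcP hcd

/-! ## The collar count -/

/-- **Stub S5 `stub_collarCount` of the line `pinned-equilibria-reduction`** (crux
`ReggeStarCoercivity.PeriodicStarCoercivity`, stmt-AtomisticToContinuum-13602): the number of `7/100`-near motif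
sites within `R` of the junk is at most `40 R³` per far-defective motif site. Proof: choose a far witness
`y = m + g` (`m ∈ farDefSet P` by lattice invariance of statuses); `s ↦ s − g` is injective on the motif
(inequivalence mod `G`) and lands in the near points of `P` within `R` of `m`, which are `0.837`-separated
(`dist_ge_of_near`), hence at most `40 R³` per `m` by the volume packing bound. -/
theorem stub_collarCount : ∃ C : ℝ, ∀ R : ℝ, 1 ≤ R → ∀ P : PC,
    ((collarSet R P).card : ℝ) ≤ C * R ^ 3 * ((farDefSet P).card : ℝ) := by
  refine ⟨40, fun R hR P => ?_⟩
  have hw : ∀ s ∈ collarSet R P, ∃ m ∈ farDefSet P, ∃ g ∈ P.lattice, dist (s - g) m < R := by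
    intro s hs
    have hs' := Finset.mem_filter.1 hs
    obtain ⟨_, hsN, hni⟩ := hs'
    unfold Isolated at hni
    push Not at hni
    obtain ⟨y, hy, hfar, hdist⟩ := hni
    obtain ⟨m, hm, g, hg, rfl⟩ := hy
    refine ⟨m, ?_, g, hg, ?_⟩
    · unfold farDefSet defectSet
      simp only [Finset.mem_filter]
      unfold IsFarDef at hfar
      exact ⟨⟨hm, fun hf => hfar.1 ((isFree_add_iff P hg m).2 hf)⟩,
        fun hn => hfar.2 ((near_add_iff _ P hg m).2 hn)⟩
    · have : dist (s - g) m = dist s (m + g) := by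
        rw [dist_eq_norm, dist_eq_norm]; congr 1; abel
      rw [this]; exact hdist
  choose! mfun hmT gfun hgL hdist using hw
  set ψ : E3 → E3 := fun s => s - gfun s with hψ
  have hinj : Set.InjOn ψ (collarSet R P) := by
    intro s₁ h₁ s₂ h₂ heq
    have hs₁ : s₁ ∈ P.motif := (Finset.mem_filter.1 h₁).1
    have hs₂ : s₂ ∈ P.motif := (Finset.mem_filter.1 h₂).1
    apply P.eq_of_sub_mem s₁ hs₁ s₂ hs₂
    have heq' : s₁ - gfun s₁ = s₂ - gfun s₂ := heq
    have : s₁ - s₂ = gfun s₁ - gfun s₂ := by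
      rw [sub_eq_sub_iff_sub_eq_sub] at heq'
      exact heq'
    rw [this]
    exact P.lattice.sub_mem (hgL s₁ h₁) (hgL s₂ h₂)
  let N : E3 → Finset E3 := fun m =>
    (P.finite_inter_points (K := Metric.closedBall m R) Metric.isBounded_closedBall).toFinset.filter
      fun c => Near (7 / 100) P c
  have himg : (collarSet R P).image ψ ⊆ (farDefSet P).biUnion N := by
    intro c hc
    obtain ⟨s, hs, rfl⟩ := Finset.mem_image.1 hc
    refine Finset.mem_biUnion.2 ⟨mfun s, hmT s hs, ?_⟩
    simp only [N, Finset.mem_filter, Set.Finite.mem_toFinset, Set.mem_inter_iff, Metric.mem_closedBall]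
    have hsm : s ∈ P.motif := (Finset.mem_filter.1 hs).1
    have hsN : Near (7 / 100) P s := (Finset.mem_filter.1 hs).2.1
    refine ⟨⟨(hdist s hs).le, ?_⟩, ?_⟩
    · have := P.add_mem_points (P.mem_points_of_mem_motif hsm) (P.lattice.neg_mem (hgL s hs))
      simpa [hψ, sub_eq_add_neg] using this
    · have := (near_add_iff (7 / 100) P (P.lattice.neg_mem (hgL s hs)) s).2 hsN
      simpa [hψ, sub_eq_add_neg] using this
  have hcardN : ∀ m ∈ farDefSet P, ((N m).card : ℝ) ≤ 40 * R ^ 3 := by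
    intro m _
    refine card_near_ball_le P m hR (N m) fun c hc => ?_
    simp only [N, Finset.mem_filter, Set.Finite.mem_toFinset, Set.mem_inter_iff, Metric.mem_closedBall] at hc
    exact ⟨hc.1.2, hc.2, hc.1.1⟩
  calc ((collarSet R P).card : ℝ) = (((collarSet R P).image ψ).card : ℝ) := by
        rw [Finset.card_image_of_injOn hinj]
    _ ≤ (((farDefSet P).biUnion N).card : ℝ) := by exact_mod_cast Finset.card_le_card himg
    _ ≤ ∑ m ∈ farDefSet P, ((N m).card : ℝ) := by exact_mod_cast Finset.card_biUnion_le
    _ ≤ ∑ m ∈ farDefSet P, 40 * R ^ 3 := Finset.sum_le_sum hcardN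
    _ = 40 * R ^ 3 * ((farDefSet P).card : ℝ) := by rw [Finset.sum_const, nsmul_eq_mul]; ring

end Summit.AtomisticToContinuum.Crystallization.Theorems.ReggeStarCoercivityPeriodicStarCoercivity

end
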